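import Summits.HubbardSuperconductivity.HubbardSuperconductivity.Theses.DeformationLadder
import Summits.HubbardSuperconductivity.HubbardSuperconductivity.Theorems.DeformationLadderLowEnergyRigidityDefs
import Summits.HubbardSuperconductivity.HubbardSuperconductivity.Theorems.DeformationLadderLadderThesisRigidityReduction
import Summits.HubbardSuperconductivity.HubbardSuperconductivity.Theorems.DeformationLadderLowEnergyRigidityMesoPenalised

/-!
# Crux-triage r2-3, idea `penalty-selects-the-adversary` (crux stmt-HubbardSuperconductivity-1890 `LadderThesis`)

Kernel check of the deciding triager's structural claim (refuter-cruxtri-stmt-HubbardSuperconductivity-1890-r2-3-0,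
2026-08-16): **over the card's own thermodynamic base, the infrared residual (B′) `PenalisedWindowBound` and the
crux AT the point `(U, δ, s)` are the same statement up to the pinning gap.**

The card's first lemma is `A′(θ, ε, R) ∧ B′(s, σ, R) ⟹ LadderThesis (a := θ − σ)` where A′ =
`CondensationGapWith` ("block pair order ≤ θ costs extensive energy εL²").  Its thermodynamic MIRROR
`CondensationCeilingWith` ("block pair order ≥ μ costs extensive energy εL²"; the other one-sided derivative of the
same block-penalised energy density, equally extensive / Griffiths-grade, and granted by the card in point 5:
"the upper matrix is thermodynamically pinned") gives the converse transfer

  `A′-mirror(μ, ε, R) ∧ crux_at(s, a) ⟹ B′(s, σ := μ − a, R)`     (`penalisedWindowBound_of_ceiling_of_ladderThesisAt`)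

by the SAME one-line inheritance (`⟨H_L⟩_{φ_s} ≤ E₀ + 32 s < E₀ + εL²`).  Hence, under two-sided pinning with
gap `μ − θ` (→ 0 as the pinning tightens), `B′(σ) ⟹ crux_at(θ − σ) ⟹ B′(μ − θ + σ)`: the round trip costs exactly
the pinning gap and nothing O(1) (`windowBound_iff_crux_mod_pinning`).  (B′) is the crux read through
`LRO = block order − window excess`; the card's O(1) content therefore sits entirely in the proposed SUPPLIER of
(B′) — the susceptibility ceiling (T_s) for the penalised ground state — not in (B′).

Definitions `statN`, `CondensationGapWith`, `PenalisedWindowBound` are copied VERBATIM from the ideator's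
`Cruxes/LadderThesis/SketchIdeator5.lean`; `LadderThesisAt` is the body of the route decl `LadderThesis` at
`(U, δ, s, a)` (`ladderThesis_iff_exists_at : … := Iff.rfl`).
-/

noncomputable section

namespace CruxTriage.PenaltyAdversary

open Matrix
open scoped ComplexOrder
open Literature.MathematicalPhysics.QuantumLattice Literature.Probability.LatticeModels
open Summit.HubbardSuperconductivity.HubbardSuperconductivity.Theses.DeformationLadder
open Summit.HubbardSuperconductivity.HubbardSuperconductivity.Theorems
open Summit.HubbardSuperconductivity.HubbardSuperconductivity.Theorems.LowEnergyRigidity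
open Summit.HubbardSuperconductivity.HubbardSuperconductivity.Theorems.DeformationLadder

/-- (verbatim, SketchIdeator5) the summit's electron number `N_L = 2⌊(1-δ)L²/2⌋`. -/
noncomputable abbrev statN (δ : ℝ) (L : ℕ) : ℕ := 2 * ⌊(1 - δ) * (L : ℝ) ^ 2 / 2⌋₊

/-- (verbatim, SketchIdeator5) **(A′)** condensation gap with parameters `(θ, ε, R)` at `(U, δ)`. -/
def CondensationGapWith (U δ θ ε : ℝ) (R : ℕ) : Prop :=
  ∃ L₀ : ℕ, ∀ (L : ℕ) [NeZero L], L₀ ≤ L → Even L →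
    ∀ φ : Fock (Orb (FermionTorus 2 L)),
      φ ∈ szSector (Λ := FermionTorus 2 L) (statN δ L) 0 →
      star φ ⬝ᵥ φ = 1 →
      (expect (mesoOp L R) φ).re / ((L : ℝ) ^ 2 * (R : ℝ) ^ 4) ≤ θ →
      (hubbardTorus 2 L 1 U).minEnergyOn (szSector (Λ := FermionTorus 2 L) (statN δ L) 0) +
          ε * (L : ℝ) ^ 2 ≤
        (star φ ⬝ᵥ Matrix.mulVec (hubbardTorus 2 L 1 U) φ).re

/-- (verbatim, SketchIdeator5) **(B′)** penalised window bound — the card's residual. -/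
def PenalisedWindowBound (U δ s σ : ℝ) (R : ℕ) : Prop :=
  ∃ L₀ : ℕ, ∀ (L : ℕ) [NeZero L], L₀ ≤ L → Even L →
    ∃ φ : Fock (Orb (FermionTorus 2 L)), star φ ⬝ᵥ φ = 1 ∧
      IsGroundStateInSector (hubbardTorus 2 L 1 U + ((s / (L : ℝ) ^ 4 : ℝ) : ℂ) •
        ((pairField dWaveFormFactor L)ᴴ * pairField dWaveFormFactor L)) (statN δ L) 0 φ ∧
      (expect (mesoOp L R) φ).re / ((L : ℝ) ^ 2 * (R : ℝ) ^ 4) -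
        (expect ((pairField dWaveFormFactor L)ᴴ * pairField dWaveFormFactor L) φ).re /
          (L : ℝ) ^ 4 ≤ σ

/-- **(A′-mirror)** condensation CEILING with parameters `(μ, ε, R)` at `(U, δ)`: every unit sector vector
with block pair order `≥ μ` pays extensive energy `≥ εL²` above the sector bottom.  The right one-sided
derivative of the block-penalised energy density where (A′) is the left one; thermodynamic, same grade as (A′). -/
def CondensationCeilingWith (U δ μ ε : ℝ) (R : ℕ) : Prop :=
  ∃ L₀ : ℕ, ∀ (L : ℕ) [NeZero L], L₀ ≤ L → Even L →
    ∀ φ : Fock (Orb (FermionTorus 2 L)),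
      φ ∈ szSector (Λ := FermionTorus 2 L) (statN δ L) 0 →
      star φ ⬝ᵥ φ = 1 →
      μ ≤ (expect (mesoOp L R) φ).re / ((L : ℝ) ^ 2 * (R : ℝ) ^ 4) →
      (hubbardTorus 2 L 1 U).minEnergyOn (szSector (Λ := FermionTorus 2 L) (statN δ L) 0) +
          ε * (L : ℝ) ^ 2 ≤
        (star φ ⬝ᵥ Matrix.mulVec (hubbardTorus 2 L 1 U) φ).re

/-- **The crux at the point** `(U, δ, s, a)`: the body of `LadderThesis` after its four leading `∃`. -/
def LadderThesisAt (U δ s a : ℝ) : Prop :=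
  ∃ L₀ : ℕ, ∀ (L : ℕ) [NeZero L], L₀ ≤ L → Even L →
    ∃ φ : Fock (Orb (FermionTorus 2 L)), star φ ⬝ᵥ φ = 1 ∧
      IsGroundStateInSector (hubbardTorus 2 L 1 U + ((s / (L : ℝ) ^ 4 : ℝ) : ℂ) •
        ((pairField dWaveFormFactor L)ᴴ * pairField dWaveFormFactor L)) (statN δ L) 0 φ ∧
      a ≤ (expect ((pairField dWaveFormFactor L)ᴴ * pairField dWaveFormFactor L) φ).re / (L : ℝ) ^ 4

/-- `LadderThesis` is literally `∃ U > 0, ∃ δ ∈ (0,1/2), ∃ s > 0, ∃ a > 0, LadderThesisAt U δ s a`. -/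
theorem ladderThesis_iff_exists_at :
    LadderThesis ↔ ∃ U : ℝ, 0 < U ∧ ∃ δ ∈ Set.Ioo (0:ℝ) (1 / 2), ∃ s : ℝ, 0 < s ∧ ∃ a : ℝ, 0 < a ∧
      LadderThesisAt U δ s a :=
  Iff.rfl

/-- Inheritance (one line, as in the sketch): the `H_L`-energy of a normalised sector ground state of the
penalised torus is at most `minEnergyOn H_L K + 32 s`. -/
theorem re_energy_le_of_penalisedGroundState {U s : ℝ} (hs : 0 ≤ s) {L : ℕ} [NeZero L] {N : ℕ}
    {φ : Fock (Orb (FermionTorus 2 L))} (hφ1 : star φ ⬝ᵥ φ = 1)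
    (hGS : IsGroundStateInSector (hubbardTorus 2 L 1 U + ((s / (L : ℝ) ^ 4 : ℝ) : ℂ) •
      ((pairField dWaveFormFactor L)ᴴ * pairField dWaveFormFactor L)) N 0 φ) :
    (star φ ⬝ᵥ Matrix.mulVec (hubbardTorus 2 L 1 U) φ).re ≤
      (hubbardTorus 2 L 1 U).minEnergyOn (szSector (Λ := FermionTorus 2 L) N 0) + 32 * s := by
  obtain ⟨hmem, -, heig⟩ := hGS
  set P := (pairField dWaveFormFactor L)ᴴ * pairField dWaveFormFactor L with hP
  set H := hubbardTorus 2 L 1 U with hH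
  set K := szSector (Λ := FermionTorus 2 L) N 0 with hK
  have hL4 : (0 : ℝ) < (L : ℝ) ^ 4 := by
    have : (0 : ℝ) < L := by exact_mod_cast Nat.pos_of_ne_zero (NeZero.ne L)
    positivity
  have hEs : (star φ ⬝ᵥ ((H + ((s / (L : ℝ) ^ 4 : ℝ) : ℂ) • P) *ᵥ φ)).re =
      (H + ((s / (L : ℝ) ^ 4 : ℝ) : ℂ) • P).minEnergyOn K := by
    rw [heig, dotProduct_smul, hφ1, smul_eq_mul, mul_one, Complex.ofReal_re]
  rw [add_mulVec, dotProduct_add, Complex.add_re, smul_mulVec, dotProduct_smul, smul_eq_mul,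
    Complex.re_ofReal_mul] at hEs
  have hpen := minEnergyOn_penalised_le L U hs K ⟨φ, hmem, hφ1⟩
  have hPnn : 0 ≤ (star φ ⬝ᵥ (P *ᵥ φ)).re := re_expect_pairPenalty_nonneg L φ
  have hnn : 0 ≤ s / (L : ℝ) ^ 4 * (star φ ⬝ᵥ (P *ᵥ φ)).re :=
    mul_nonneg (div_nonneg hs hL4.le) hPnn
  linarith

/-- Arithmetic used twice: for `L ≥ 1` with `32 s / ε < L`, `32 s < ε L²`. -/
theorem thirtytwo_mul_lt {s ε : ℝ} (hε : 0 < ε) {L : ℕ} (hL1 : 1 ≤ L) (hL : 32 * s / ε < (L : ℝ)) :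
    32 * s < ε * (L : ℝ) ^ 2 := by
  have hLr : (1 : ℝ) ≤ (L : ℝ) := by exact_mod_cast hL1
  rw [div_lt_iff₀ hε] at hL
  have hL1r : (0 : ℝ) ≤ (L : ℝ) - 1 := by linarith
  have h2 : (L : ℝ) * ε ≤ ε * (L : ℝ) ^ 2 := by nlinarith [mul_nonneg hε.le hL1r, hLr]
  linarith

/-- **Forward (the card's first lemma, pointwise): `A′(θ) ∧ B′(σ) ⟹ crux_at(θ − σ)`.** -/
theorem ladderThesisAt_of_gap_of_windowBound {U δ θ ε s σ : ℝ} {R : ℕ}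
    (hε : 0 < ε) (hs : 0 ≤ s)
    (hA : CondensationGapWith U δ θ ε R) (hB : PenalisedWindowBound U δ s σ R) :
    LadderThesisAt U δ s (θ - σ) := by
  obtain ⟨LA, hA⟩ := hA
  obtain ⟨LB, hB⟩ := hB
  obtain ⟨L₁, hL₁⟩ : ∃ L₁ : ℕ, 32 * s / ε < (L₁ : ℝ) := exists_nat_gt _
  refine ⟨max LA (max LB (max L₁ 1)), fun L _ hL hLe => ?_⟩
  have hLA : LA ≤ L := le_trans (le_max_left _ _) hL
  have hLB : LB ≤ L := le_trans ((le_max_left _ _).trans (le_max_right _ _)) hL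
  have hL1 : L₁ ≤ L :=
    le_trans (((le_max_left _ _).trans (le_max_right _ _)).trans (le_max_right _ _)) hL
  have hLone : 1 ≤ L :=
    le_trans (((le_max_right _ _).trans (le_max_right _ _)).trans (le_max_right _ _)) hL
  obtain ⟨φ, hφ1, hGS, hwin⟩ := hB L hLB hLe
  refine ⟨φ, hφ1, hGS, ?_⟩
  have hmem : φ ∈ szSector (Λ := FermionTorus 2 L) (statN δ L) 0 := hGS.1
  have hHle := re_energy_le_of_penalisedGroundState hs hφ1 hGS
  have h32 : 32 * s < ε * (L : ℝ) ^ 2 :=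
    thirtytwo_mul_lt hε hLone (lt_of_lt_of_le hL₁ (by exact_mod_cast hL1))
  have hmeso : θ < (expect (mesoOp L R) φ).re / ((L : ℝ) ^ 2 * (R : ℝ) ^ 4) := by
    by_contra hle
    have h := hA L hLA hLe φ hmem hφ1 (not_lt.mp hle)
    linarith
  linarith

/-- **Converse (new): `A′-mirror(μ) ∧ crux_at(a) ⟹ B′(μ − a)`** — the same inheritance line, read the
other way: the crux's penalised ground state has `H_L`-energy `≤ E₀ + 32 s < E₀ + εL²`, so by the ceiling its
block order is `< μ`, and its window excess is `< μ − a`. -/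
theorem penalisedWindowBound_of_ceiling_of_ladderThesisAt {U δ μ ε s a : ℝ} {R : ℕ}
    (hε : 0 < ε) (hs : 0 ≤ s)
    (hC : CondensationCeilingWith U δ μ ε R) (hX : LadderThesisAt U δ s a) :
    PenalisedWindowBound U δ s (μ - a) R := by
  obtain ⟨LC, hC⟩ := hC
  obtain ⟨LX, hX⟩ := hX
  obtain ⟨L₁, hL₁⟩ : ∃ L₁ : ℕ, 32 * s / ε < (L₁ : ℝ) := exists_nat_gt _
  refine ⟨max LC (max LX (max L₁ 1)), fun L _ hL hLe => ?_⟩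
  have hLC : LC ≤ L := le_trans (le_max_left _ _) hL
  have hLX : LX ≤ L := le_trans ((le_max_left _ _).trans (le_max_right _ _)) hL
  have hL1 : L₁ ≤ L :=
    le_trans (((le_max_left _ _).trans (le_max_right _ _)).trans (le_max_right _ _)) hL
  have hLone : 1 ≤ L :=
    le_trans (((le_max_right _ _).trans (le_max_right _ _)).trans (le_max_right _ _)) hL
  obtain ⟨φ, hφ1, hGS, ha⟩ := hX L hLX hLe
  refine ⟨φ, hφ1, hGS, ?_⟩
  have hmem : φ ∈ szSector (Λ := FermionTorus 2 L) (statN δ L) 0 := hGS.1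
  have hHle := re_energy_le_of_penalisedGroundState hs hφ1 hGS
  have h32 : 32 * s < ε * (L : ℝ) ^ 2 :=
    thirtytwo_mul_lt hε hLone (lt_of_lt_of_le hL₁ (by exact_mod_cast hL1))
  have hmeso : (expect (mesoOp L R) φ).re / ((L : ℝ) ^ 2 * (R : ℝ) ^ 4) < μ := by
    by_contra hge
    have h := hC L hLC hLe φ hmem hφ1 (not_lt.mp hge)
    linarith
  linarith

/-- **Net — (B′) ⟺ crux modulo two-sided pinning.**  Under (A′) at `θ` and its mirror at `μ` (same `ε, R`),
for every penalty strength `s ≥ 0`: `B′(σ) → crux_at(θ − σ)` and `crux_at(a) → B′(μ − a)`; the round trip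
`σ ↦ (μ − θ) + σ` loses only the pinning gap `μ − θ`. -/
theorem windowBound_iff_crux_mod_pinning {U δ θ μ ε s : ℝ} {R : ℕ} (hε : 0 < ε) (hs : 0 ≤ s)
    (hA : CondensationGapWith U δ θ ε R) (hC : CondensationCeilingWith U δ μ ε R) :
    (∀ σ : ℝ, PenalisedWindowBound U δ s σ R → LadderThesisAt U δ s (θ - σ)) ∧
      (∀ a : ℝ, LadderThesisAt U δ s a → PenalisedWindowBound U δ s (μ - a) R) :=
  ⟨fun _ hB => ladderThesisAt_of_gap_of_windowBound hε hs hA hB,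
    fun _ hX => penalisedWindowBound_of_ceiling_of_ladderThesisAt hε hs hC hX⟩

/-- Sanity: two-sided pinning is consistent only with `θ < μ` once the sector is inhabited by a state of
`H_L`-energy below `E₀ + εL²` — e.g. any penalised ground state — so the round-trip loss `μ − θ` is a genuine
nonnegative gap, not a sign artefact. -/
theorem gap_pos_of_pinning {U δ θ μ ε s : ℝ} {R : ℕ} (hε : 0 < ε) (hs : 0 ≤ s)
    (hA : CondensationGapWith U δ θ ε R) (hC : CondensationCeilingWith U δ μ ε R)
    (hX : LadderThesisAt U δ s 0) : θ < μ := by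
  obtain ⟨LA, hA⟩ := hA
  obtain ⟨LC, hC⟩ := hC
  obtain ⟨LX, hX⟩ := hX
  obtain ⟨L₁, hL₁⟩ : ∃ L₁ : ℕ, 32 * s / ε < (L₁ : ℝ) := exists_nat_gt _
  -- an even side beyond all thresholds
  obtain ⟨N, hN⟩ : ∃ N : ℕ, N = 2 * (LA + LC + LX + L₁ + 1) := ⟨_, rfl⟩
  have hLA : LA ≤ N := by omega
  have hLC : LC ≤ N := by omega
  have hLX : LX ≤ N := by omega
  have hL1 : L₁ ≤ N := by omega
  have hone : 1 ≤ N := by omega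
  haveI : NeZero N := ⟨by omega⟩
  have hEven : Even N := ⟨LA + LC + LX + L₁ + 1, by omega⟩
  obtain ⟨φ, hφ1, hGS, -⟩ := hX N hLX hEven
  have hmem : φ ∈ szSector (Λ := FermionTorus 2 N) (statN δ N) 0 := hGS.1
  have hHle := re_energy_le_of_penalisedGroundState hs hφ1 hGS
  have h32 : 32 * s < ε * (N : ℝ) ^ 2 :=
    thirtytwo_mul_lt hε hone (lt_of_lt_of_le hL₁ (by exact_mod_cast hL1))
  have hlow : θ < (expect (mesoOp N R) φ).re / ((N : ℝ) ^ 2 * (R : ℝ) ^ 4) := by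
    by_contra hle
    have h := hA N hLA hEven φ hmem hφ1 (not_lt.mp hle)
    linarith
  have hup : (expect (mesoOp N R) φ).re / ((N : ℝ) ^ 2 * (R : ℝ) ^ 4) < μ := by
    by_contra hge
    have h := hC N hLC hEven φ hmem hφ1 (not_lt.mp hge)
    linarith
  linarith

end CruxTriage.PenaltyAdversary
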